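import Literature.NumberTheory.Automorphic.ArchGardingEnd
import Literature.NumberTheory.Automorphic.ArchPlaceCasimirScalar
import Literature.NumberTheory.Automorphic.ArchWhittakerInfinitesimal
import Literature.Algebra.Lie.WhittakerFunctionalFiltration
import HarnessLib

/-!
# The root letters of `𝔤𝔩₂(K_∞)` on the Gårding space and their relations (input to JS I, Prop. (3.8), `r = 2`)

Topic `NumberTheory/Automorphic`; namespace `Literature.NumberTheory.Automorphic`. Definitions with
bodies and theorems (no named fact). For an irreducible unitary strongly continuous representation `τ`
of `GL₂(K_∞)` (`K_∞ = mixedSpace K = ℝ^{r₁} × ℂ^{r₂}`) on a Hilbert space, with Gårding space `𝒢` and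
the infinitesimal action `D(X) = gardingEnd hτ X ∈ End(𝒢)` (`ArchGardingEnd`), this file sets up the
data of the abstract descent lemma `Literature.Algebra.Lie.WhittakerDescent.mem_zero_of_mem_of_covariant`
for the pair (Borel subalgebra `𝔟`, lowering letters `E₁₀`):

* `GL2Letter K = {w real} ⊕ ({w complex} × Bool)` indexes a basis of root letters adapted to the
  places: for a real place the letter `E_{ij} ⊗ r_w` (`r_w = (1_w, 0)`), for a complex place the
  holomorphic / antiholomorphic letters `E_{ij} ⊗ c_w ∓ i · E_{ij} ⊗ (i c_w)` (`c_w = (0, 1_w)`);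
  `placeLetter hτ i j a ∈ End(𝒢)` is the corresponding operator.
* `borelAlg hτ = ℂ⟨D(E₀₀ ⊗ x), D(E₀₁ ⊗ x) : x ∈ K_∞⟩`, the subalgebra `B`; `D(E₁₁ ⊗ x) ∈ B` because the
  centre acts by scalars (`ArchGardingSegal.exists_archDerivE_scalar_eq_smul`).
* the relations: (H1) `e⁻_a b ∈ B e⁻_a + B` (`placeLetter_one_zero_mul_mem`), (H2)
  `e⁻_a e⁺_a ∈ B` from the place Casimir scalars (`ArchPlaceCasimirScalar`), (H3)
  `[e⁻_a, e⁺_{a'}] = 0` for `a ≠ a'`, the infinitesimal Whittaker covariance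
  `ℓ ∘ e⁺_a = θ_a ℓ`, `θ_a ≠ 0` (`ArchWhittakerInfinitesimal`), and the degree bound: every
  `D(E_{ij} ⊗ x)` has finite `e⁻`-degree over `B` (`exists_mem_degFilt_gardingEnd_single`).

This is the Lie-algebra bookkeeping of Jacquet–Shalika (1981), §3, (3.4) and proof of Prop. (3.8)
(p. 523) specialised to `r = 2`, where `P ∩ \bar N = {1}` makes the `Y`-variables exactly the
lowering letters; consumed by `ArchWhittakerPContinuityGL2`.

## References

* H. Jacquet, J. A. Shalika, *On Euler products and the classification of automorphic
  representations I*, Amer. J. Math. 103 (1981), §3, Lemma (3.4), Prop. (3.8) [JacquetShalikaAJM1981].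
* A. W. Knapp, *Representation Theory of Semisimple Groups*, Princeton (1986), Ch. VIII §3 [Knapp1986].
-/

noncomputable section

open MeasureTheory Measure NumberField NumberField.mixedEmbedding NumberField.InfinitePlace IsDedekindDomain Set Filter
  Complex
open scoped MatrixGroups ENNReal NNReal Classical Topology InnerProductSpace ComplexConjugate Real

namespace Literature.NumberTheory.Automorphic

variable {K : Type} [Field K] [NumberField K]

attribute [local instance] glInfBorel borelSpace_glInf locallyCompactSpace_glInf secondCountableTopology_glInf

-- as in `ArchGardingWhittaker`
set_option backward.isDefEq.respectTransparency false

/-! ### 1. Letters adapted to the places -/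

variable (K) in
/-- The index set of the root letters of `𝔤𝔩₂(K_∞) ⊗ ℂ` adapted to the places: a real place `w`, or a
complex place `w` with a flag (`false` = holomorphic, `true` = antiholomorphic). [folklore] -/
abbrev GL2Letter : Type := {w : InfinitePlace K // IsReal w} ⊕ ({w : InfinitePlace K // IsComplex w} × Bool)

variable (K) in
/-- First direction vector of a letter: `r_w = (1_w, 0)` (real) or `c_w = (0, 1_w)` (complex). [folklore] -/
def letterVec₁ : GL2Letter K → mixedSpace K
  | Sum.inl w => (Pi.single w 1, 0)
  | Sum.inr p => (0, Pi.single p.1 1)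

variable (K) in
/-- Second direction vector of a letter: `0` (real) or `i c_w = (0, i 1_w)` (complex). [folklore] -/
def letterVec₂ : GL2Letter K → mixedSpace K
  | Sum.inl _ => 0
  | Sum.inr p => (0, Pi.single p.1 I)

variable (K) in
/-- Coefficient of the second direction: `0` (real), `-i` (holomorphic), `+i` (antiholomorphic). [folklore] -/
def letterCoef : GL2Letter K → ℂ
  | Sum.inl _ => 0
  | Sum.inr (_, false) => -I
  | Sum.inr (_, true) => I

/-- The `ad(𝔥)`-eigenvalue attached to a letter and `y ∈ K_∞`: `y_w` (real), `y_w` (holomorphic),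
`conj y_w` (antiholomorphic). [folklore] -/
def letterEval : GL2Letter K → mixedSpace K → ℂ
  | Sum.inl w, y => ((y.1 w : ℝ) : ℂ)
  | Sum.inr (w, false), y => y.2 w
  | Sum.inr (w, true), y => conj (y.2 w)

/-- The coordinate of `x ∈ K_∞` along a letter: `x_w` (real), `x_w / 2` (holomorphic), `conj x_w / 2`
(antiholomorphic), so that `E ⊗ x = Σ_a letterCoord a x · (letter a)`. [folklore] -/
def letterCoord : GL2Letter K → mixedSpace K → ℂ
  | Sum.inl w, x => ((x.1 w : ℝ) : ℂ)
  | Sum.inr (w, false), x => x.2 w / 2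
  | Sum.inr (w, true), x => conj (x.2 w) / 2

/-- The Whittaker eigenvalue of the raising letter: `-2πi` (real place), `-4πi` (complex place).
[folklore] -/
def letterChar : GL2Letter K → ℂ
  | Sum.inl _ => -(2 * π) * I
  | Sum.inr _ => -(4 * π) * I

omit [NumberField K] in
/-- `letterChar a ≠ 0`. [folklore] -/
theorem letterChar_ne_zero (a : GL2Letter K) : letterChar a ≠ 0 := by
  rcases a with w | p
  · simp [letterChar, Real.pi_ne_zero, Complex.I_ne_zero]
  · simp [letterChar, Real.pi_ne_zero, Complex.I_ne_zero]

/-! ### 2. Products of the direction vectors in `K_∞` -/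

section Products

omit [NumberField K]

/-- `r_w · y = y_w · r_w`. [folklore] -/
theorem realIdem_mul (w : {w : InfinitePlace K // IsReal w}) (y : mixedSpace K) :
    ((Pi.single w 1, 0) : mixedSpace K) * y = (y.1 w) • ((Pi.single w 1, 0) : mixedSpace K) := by
  refine Prod.ext (funext fun w' => ?_) (funext fun w' => ?_)
  · simp only [Prod.fst_mul, Pi.mul_apply, Prod.smul_fst, Pi.smul_apply, smul_eq_mul]
    by_cases h : w' = w
    · subst h; simp
    · simp [Pi.single_eq_of_ne h]
  · simp

/-- `c_w · y = Re(y_w) c_w + Im(y_w) (i c_w)`. [folklore] -/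
theorem complexIdem_mul (w : {w : InfinitePlace K // IsComplex w}) (y : mixedSpace K) :
    ((0, Pi.single w 1) : mixedSpace K) * y =
      (y.2 w).re • ((0, Pi.single w 1) : mixedSpace K) + (y.2 w).im • ((0, Pi.single w I) : mixedSpace K) := by
  have h := mul_complexIdem_mul w 1 y
  rw [one_mul] at h
  simpa using h

/-- `(i c_w) · y = -Im(y_w) c_w + Re(y_w) (i c_w)`. [folklore] -/
theorem complexIdemI_mul (w : {w : InfinitePlace K // IsComplex w}) (y : mixedSpace K) :
    ((0, Pi.single w I) : mixedSpace K) * y =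
      (-(y.2 w).im) • ((0, Pi.single w 1) : mixedSpace K) + (y.2 w).re • ((0, Pi.single w I) : mixedSpace K) := by
  have h := mul_complexIdemI_mul w 1 y
  rw [one_mul] at h
  simpa using h

/-- `r_w r_{w'} = δ_{ww'} r_w`. [folklore] -/
theorem realIdem_mul_realIdem (w w' : {w : InfinitePlace K // IsReal w}) :
    ((Pi.single w 1, 0) : mixedSpace K) * ((Pi.single w' 1, 0) : mixedSpace K) =
      if w = w' then ((Pi.single w 1, 0) : mixedSpace K) else 0 := by
  rw [realIdem_mul]
  by_cases h : w = w'
  · subst h; simp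
  · rw [if_neg h]
    simp [Pi.single_eq_of_ne h]

/-- `r_w r_w = r_w`. [folklore] -/
theorem realIdem_mul_self (w : {w : InfinitePlace K // IsReal w}) :
    ((Pi.single w 1, 0) : mixedSpace K) * ((Pi.single w 1, 0) : mixedSpace K) = ((Pi.single w 1, 0) : mixedSpace K) := by
  rw [realIdem_mul_realIdem, if_pos rfl]

/-- `r_w r_{w'} = 0` for `w ≠ w'`. [folklore] -/
theorem realIdem_mul_realIdem_of_ne {w w' : {w : InfinitePlace K // IsReal w}} (h : w ≠ w') :
    ((Pi.single w 1, 0) : mixedSpace K) * ((Pi.single w' 1, 0) : mixedSpace K) = 0 := by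
  rw [realIdem_mul_realIdem, if_neg h]

/-- `r_w · (0, f) = 0`. [folklore] -/
theorem realIdem_mul_inr (w : {w : InfinitePlace K // IsReal w}) (f : {w : InfinitePlace K // IsComplex w} → ℂ) :
    ((Pi.single w 1, 0) : mixedSpace K) * ((0, f) : mixedSpace K) = 0 := by
  rw [realIdem_mul]; simp

/-- `(0, f) · r_w = 0`. [folklore] -/
theorem inr_mul_realIdem (w : {w : InfinitePlace K // IsReal w}) (f : {w : InfinitePlace K // IsComplex w} → ℂ) :
    ((0, f) : mixedSpace K) * ((Pi.single w 1, 0) : mixedSpace K) = 0 := by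
  rw [mul_comm]; exact realIdem_mul_inr w f

/-- `(0, a 1_w) (0, b 1_{w'}) = δ_{ww'} (0, ab 1_w)`. [folklore] -/
theorem inrSingle_mul_inrSingle (w w' : {w : InfinitePlace K // IsComplex w}) (a b : ℂ) :
    ((0, Pi.single w a) : mixedSpace K) * ((0, Pi.single w' b) : mixedSpace K) =
      if w = w' then ((0, Pi.single w (a * b)) : mixedSpace K) else 0 := by
  by_cases h : w = w'
  · subst h
    rw [if_pos rfl]
    refine Prod.ext (by simp) (funext fun v => ?_)
    simp only [Prod.snd_mul, Pi.mul_apply]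
    by_cases hv : v = w
    · subst hv; simp
    · simp [Pi.single_eq_of_ne hv]
  · rw [if_neg h]
    refine Prod.ext (by simp) (funext fun v => ?_)
    simp only [Prod.snd_mul, Pi.mul_apply, Prod.snd_zero, Pi.zero_apply]
    by_cases hv : v = w
    · subst hv; simp [Pi.single_eq_of_ne h]
    · simp [Pi.single_eq_of_ne hv]

/-- `(0, a 1_w) (0, b 1_w) = (0, ab 1_w)`. [folklore] -/
theorem inrSingle_mul_inrSingle_same (w : {w : InfinitePlace K // IsComplex w}) (a b : ℂ) :
    ((0, Pi.single w a) : mixedSpace K) * ((0, Pi.single w b) : mixedSpace K) = ((0, Pi.single w (a * b)) : mixedSpace K) := by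
  rw [inrSingle_mul_inrSingle, if_pos rfl]

/-- `(0, a 1_w) (0, b 1_{w'}) = 0` for `w ≠ w'`. [folklore] -/
theorem inrSingle_mul_inrSingle_of_ne {w w' : {w : InfinitePlace K // IsComplex w}} (h : w ≠ w') (a b : ℂ) :
    ((0, Pi.single w a) : mixedSpace K) * ((0, Pi.single w' b) : mixedSpace K) = 0 := by
  rw [inrSingle_mul_inrSingle, if_neg h]

/-- `(0, -1_w) = -c_w`. [folklore] -/
theorem inrSingle_neg_one (w : {w : InfinitePlace K // IsComplex w}) :
    ((0, Pi.single w (-1 : ℂ)) : mixedSpace K) = -((0, Pi.single w 1) : mixedSpace K) := by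
  rw [Prod.neg_mk, neg_zero, Pi.single_neg]

/-- `E_{ij} ⊗ (-a) = -(E_{ij} ⊗ a)`. [folklore] -/
theorem single_neg' {m : ℕ} (i j : Fin m) (a : mixedSpace K) : Matrix.single i j (-a) = -Matrix.single i j a :=
  eq_neg_iff_add_eq_zero.2 (by rw [← Matrix.single_add, neg_add_cancel, Matrix.single_zero])

/-- `E_{ij} ⊗ (Σ_k f k) = Σ_k E_{ij} ⊗ f k`. [folklore] -/
theorem single_finset_sum {m : ℕ} {ι : Type*} (i j : Fin m) (t : Finset ι) (f : ι → mixedSpace K) :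
    Matrix.single i j (∑ k ∈ t, f k) = ∑ k ∈ t, Matrix.single i j (f k) :=
  map_sum (Matrix.singleAddMonoidHom i j) f t

/-- `x · 1₂ = E₀₀ ⊗ x + E₁₁ ⊗ x` in `M₂(K_∞)`. [folklore] -/
theorem smul_one_eq_single_add_single (x : mixedSpace K) :
    x • (1 : Matrix (Fin 2) (Fin 2) (mixedSpace K)) = Matrix.single 0 0 x + Matrix.single 1 1 x := by
  refine Matrix.ext fun i j => ?_
  fin_cases i <;> fin_cases j <;> simp [Matrix.single]

/-- `[E₁₀ ⊗ x, E₀₀ ⊗ y] = E₁₀ ⊗ xy`. [folklore] -/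
theorem single10_comm_single00 (x y : mixedSpace K) :
    Matrix.single (1 : Fin 2) (0 : Fin 2) x * Matrix.single 0 0 y - Matrix.single 0 0 y * Matrix.single 1 0 x =
      Matrix.single 1 0 (x * y) := by
  rw [Matrix.single_mul_single_same, Matrix.single_mul_single_of_ne _ _ _ _ (by decide), sub_zero]

/-- `[E₁₀ ⊗ x, E₀₁ ⊗ y] = E₁₁ ⊗ xy - E₀₀ ⊗ yx`. [folklore] -/
theorem single10_comm_single01 (x y : mixedSpace K) :
    Matrix.single (1 : Fin 2) (0 : Fin 2) x * Matrix.single 0 1 y - Matrix.single 0 1 y * Matrix.single 1 0 x =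
      Matrix.single 1 1 (x * y) - Matrix.single 0 0 (y * x) := by
  rw [Matrix.single_mul_single_same, Matrix.single_mul_single_same]

/-- `[E₀₁ ⊗ x, E₁₀ ⊗ y] = E₀₀ ⊗ xy - E₁₁ ⊗ yx`. [folklore] -/
theorem single01_comm_single10 (x y : mixedSpace K) :
    Matrix.single (0 : Fin 2) (1 : Fin 2) x * Matrix.single 1 0 y - Matrix.single 1 0 y * Matrix.single 0 1 x =
      Matrix.single 0 0 (x * y) - Matrix.single 1 1 (y * x) := by
  rw [Matrix.single_mul_single_same, Matrix.single_mul_single_same]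

/-- `[E₁₀ ⊗ x, E₁₁ ⊗ y] = -E₁₀ ⊗ yx`. [folklore] -/
theorem single10_comm_single11 (x y : mixedSpace K) :
    Matrix.single (1 : Fin 2) (0 : Fin 2) x * Matrix.single 1 1 y - Matrix.single 1 1 y * Matrix.single 1 0 x =
      -Matrix.single 1 0 (y * x) := by
  rw [Matrix.single_mul_single_of_ne _ _ _ _ (by decide), Matrix.single_mul_single_same, zero_sub]

end Products

section Expansion

/-- **Expansion of `x ∈ K_∞` in the place basis** `{r_w} ∪ {c_w, i c_w}`. [folklore] -/
theorem eq_sum_realIdem_add_sum_complexIdem (x : mixedSpace K) :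
    x = ∑ w : {w : InfinitePlace K // IsReal w}, (x.1 w) • ((Pi.single w 1, 0) : mixedSpace K) +
      ∑ w : {w : InfinitePlace K // IsComplex w}, ((x.2 w).re • ((0, Pi.single w 1) : mixedSpace K) +
        (x.2 w).im • ((0, Pi.single w I) : mixedSpace K)) := by
  refine Prod.ext (funext fun w' => ?_) (funext fun w' => ?_)
  · simp only [Prod.fst_add, Prod.fst_sum, Prod.smul_fst, Finset.sum_apply, Pi.add_apply, Pi.smul_apply,
      smul_eq_mul, smul_zero, add_zero, Finset.sum_const_zero, Pi.zero_apply]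
    rw [Finset.sum_eq_single w' (fun b _ hb => by simp [Pi.single_eq_of_ne (Ne.symm hb)]) (fun h => absurd (Finset.mem_univ _) h)]
    simp
  · simp only [Prod.snd_add, Prod.snd_sum, Prod.smul_snd, Finset.sum_apply, Pi.add_apply, Pi.smul_apply,
      smul_zero, Finset.sum_const_zero, Pi.zero_apply, zero_add, Complex.real_smul]
    rw [Finset.sum_eq_single w' (fun b _ hb => by simp [Pi.single_eq_of_ne (Ne.symm hb)]) (fun h => absurd (Finset.mem_univ _) h)]
    simp only [Pi.single_eq_same, mul_one]
    exact (Complex.re_add_im _).symm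

end Expansion

/-! ### 3. The letters as endomorphisms of the Gårding space -/

section Letters

variable {hcpt : isCompact_glFiniteIntegralLevel 2 K}
  {E : Type*} [NormedAddCommGroup E] [InnerProductSpace ℂ E] [CompleteSpace E]
  {τ : ContRepresentation ℂ (AutomorphyDatum.gl 2 K hcpt).arch.carrier E}

/-- **The letter operator** at position `(i, j)` attached to `a`: `D(E_{ij} ⊗ r_w)` for a real place,
`D(E_{ij} ⊗ c_w) ∓ i D(E_{ij} ⊗ i c_w)` for a complex place (holomorphic / antiholomorphic part, up to the
factor `2`). [cite: Knapp1986, Ch. VIII §3] -/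
def placeLetter (hτ : τ.IsStronglyContinuous) (i j : Fin 2) (a : GL2Letter K) : Module.End ℂ (archGardingSpace hcpt τ) :=
  gardingEnd hτ (Matrix.single i j (letterVec₁ K a)) + letterCoef K a • gardingEnd hτ (Matrix.single i j (letterVec₂ K a))

/-- The real-place letter is `D(E_{ij} ⊗ r_w)`. [folklore] -/
theorem placeLetter_inl (hτ : τ.IsStronglyContinuous) (i j : Fin 2) (w : {w : InfinitePlace K // IsReal w}) :
    placeLetter (hcpt := hcpt) (τ := τ) hτ i j (Sum.inl w) = gardingEnd hτ (Matrix.single i j ((Pi.single w 1, 0) : mixedSpace K)) := by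
  simp [placeLetter, letterVec₁, letterCoef]

/-- The complex-place letters are `D(E_{ij} ⊗ c_w) + β D(E_{ij} ⊗ i c_w)`, `β = ∓ i`. [folklore] -/
theorem placeLetter_inr (hτ : τ.IsStronglyContinuous) (i j : Fin 2) (w : {w : InfinitePlace K // IsComplex w}) (b : Bool) :
    placeLetter (hcpt := hcpt) (τ := τ) hτ i j (Sum.inr (w, b)) =
      gardingEnd hτ (Matrix.single i j ((0, Pi.single w 1) : mixedSpace K)) +
        letterCoef K (Sum.inr (w, b)) • gardingEnd hτ (Matrix.single i j ((0, Pi.single w I) : mixedSpace K)) := rfl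

/-- **The general letter in the place basis**: `D(E_{ij} ⊗ x) = Σ_a letterCoord a x · placeLetter i j a`
(`x = Σ_w x_w r_w + Σ_w (Re x_w c_w + Im x_w i c_w)` and `c_w = (hol + anti)/2`, `i c_w = i (hol - anti)/2`).
[folklore] -/
theorem gardingEnd_single_eq_sum_placeLetter (hτ : τ.IsStronglyContinuous) (i j : Fin 2) (x : mixedSpace K) :
    gardingEnd (hcpt := hcpt) (τ := τ) hτ (Matrix.single i j x) = ∑ a : GL2Letter K, letterCoord a x • placeLetter hτ i j a := by
  have hx := eq_sum_realIdem_add_sum_complexIdem x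
  conv_lhs => rw [hx]
  rw [Matrix.single_add, single_finset_sum, single_finset_sum, gardingEnd_add, gardingEnd_sum, gardingEnd_sum]
  simp only [Matrix.single_add, ← Matrix.smul_single, gardingEnd_add, gardingEnd_smul]
  rw [Fintype.sum_sum_type, Fintype.sum_prod_type]
  simp only [Fintype.sum_bool, placeLetter_inl, placeLetter_inr, letterCoord, letterCoef]
  congr 1
  refine Finset.sum_congr rfl fun w _ => ?_
  set Dc := gardingEnd (hcpt := hcpt) (τ := τ) hτ (Matrix.single i j ((0, Pi.single w 1) : mixedSpace K))
  set Dic := gardingEnd (hcpt := hcpt) (τ := τ) hτ (Matrix.single i j ((0, Pi.single w I) : mixedSpace K))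
  set z : ℂ := x.2 w
  have e1 : (z.re : ℂ) + (z.im : ℂ) * I = z := Complex.re_add_im z
  have e2 : (z.re : ℂ) - (z.im : ℂ) * I = conj z := by
    have h := Complex.re_add_im (conj z)
    rwa [Complex.conj_re, Complex.conj_im, Complex.ofReal_neg, neg_mul, ← sub_eq_add_neg] at h
  have h1 : ((z.re : ℂ)) = conj z / 2 + z / 2 := by linear_combination (e1 + e2) / 2
  have h2 : ((z.im : ℂ)) = conj z / 2 * I + z / 2 * -I := by
    linear_combination (I / 2) * (e2 - e1) + (z.im : ℂ) * Complex.I_sq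
  rw [h1, h2]
  module

variable (hcpt τ) in
/-- **The Borel subalgebra** `B = ℂ⟨D(E₀₀ ⊗ x), D(E₀₁ ⊗ x) : x ∈ K_∞⟩ ⊆ End(𝒢)` (the image of `𝔘(𝔭)` for
the mirabolic/Borel `𝔭` of `𝔤𝔩₂`, up to the centre). [cite: JacquetShalikaAJM1981, §3, (3.4)] -/
def borelAlg (hτ : τ.IsStronglyContinuous) : Subalgebra ℂ (Module.End ℂ (archGardingSpace hcpt τ)) :=
  Algebra.adjoin ℂ (Set.range (fun x : mixedSpace K => gardingEnd (hcpt := hcpt) (τ := τ) hτ (Matrix.single 0 0 x)) ∪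
    Set.range (fun x : mixedSpace K => gardingEnd (hcpt := hcpt) (τ := τ) hτ (Matrix.single 0 1 x)))

/-- `D(E₀₀ ⊗ x) ∈ B`. [folklore] -/
theorem gardingEnd_single00_mem (hτ : τ.IsStronglyContinuous) (x : mixedSpace K) :
    gardingEnd hτ (Matrix.single 0 0 x) ∈ borelAlg hcpt τ hτ :=
  Algebra.subset_adjoin (Or.inl ⟨x, rfl⟩)

/-- `D(E₀₁ ⊗ x) ∈ B`. [folklore] -/
theorem gardingEnd_single01_mem (hτ : τ.IsStronglyContinuous) (x : mixedSpace K) :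
    gardingEnd hτ (Matrix.single 0 1 x) ∈ borelAlg hcpt τ hτ :=
  Algebra.subset_adjoin (Or.inr ⟨x, rfl⟩)

/-- **The centre acts by scalars**: `D(x · 1₂) = d_x · 1` on `𝒢` for irreducible unitary `τ`.
[cite: JacquetShalikaAJM1981, §3, Prop. (3.8), p. 523] -/
theorem exists_gardingEnd_smul_one_eq (hτ : τ.IsStronglyContinuous) (hτu : τ.IsUnitary) (hτi : τ.IsTopIrreducible)
    (x : mixedSpace K) :
    ∃ d : ℂ, gardingEnd (hcpt := hcpt) (τ := τ) hτ (x • (1 : Matrix (Fin 2) (Fin 2) (mixedSpace K))) = d • 1 := by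
  obtain ⟨d, hd⟩ := exists_archDerivE_scalar_eq_smul hτ hτu hτi x
  refine ⟨d, LinearMap.ext fun v => Subtype.ext ?_⟩
  rw [coe_gardingEnd_apply, hd _ v.2]
  rfl

/-- `D(E₁₁ ⊗ x) ∈ B` (as `D(E₁₁ ⊗ x) = d_x · 1 - D(E₀₀ ⊗ x)`). [folklore] -/
theorem gardingEnd_single11_mem (hτ : τ.IsStronglyContinuous) (hτu : τ.IsUnitary) (hτi : τ.IsTopIrreducible)
    (x : mixedSpace K) : gardingEnd hτ (Matrix.single 1 1 x) ∈ borelAlg hcpt τ hτ := by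
  obtain ⟨d, hd⟩ := exists_gardingEnd_smul_one_eq hτ hτu hτi x
  rw [smul_one_eq_single_add_single, gardingEnd_add] at hd
  have h : gardingEnd (hcpt := hcpt) (τ := τ) hτ (Matrix.single 1 1 x) = d • 1 - gardingEnd hτ (Matrix.single 0 0 x) := by
    rw [← hd]; abel
  rw [h]
  exact Subalgebra.sub_mem _ (Subalgebra.smul_mem _ (Subalgebra.one_mem _) d) (gardingEnd_single00_mem hτ x)

/-- `D(E_{0j} ⊗ x) ∈ B` and `D(E₁₁ ⊗ x) ∈ B`: all letters except `E₁₀`. [folklore] -/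
theorem gardingEnd_single_mem_of_ne (hτ : τ.IsStronglyContinuous) (hτu : τ.IsUnitary) (hτi : τ.IsTopIrreducible)
    {i j : Fin 2} (h : ¬(i = 1 ∧ j = 0)) (x : mixedSpace K) : gardingEnd hτ (Matrix.single i j x) ∈ borelAlg hcpt τ hτ := by
  fin_cases i <;> fin_cases j
  · exact gardingEnd_single00_mem hτ x
  · exact gardingEnd_single01_mem hτ x
  · exact absurd ⟨rfl, rfl⟩ h
  · exact gardingEnd_single11_mem hτ hτu hτi x

/-- The letters at positions `(0,0)`, `(0,1)`, `(1,1)` lie in `B`. [folklore] -/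
theorem placeLetter_mem_of_ne (hτ : τ.IsStronglyContinuous) (hτu : τ.IsUnitary) (hτi : τ.IsTopIrreducible)
    {i j : Fin 2} (h : ¬(i = 1 ∧ j = 0)) (a : GL2Letter K) : placeLetter hτ i j a ∈ borelAlg hcpt τ hτ :=
  Subalgebra.add_mem _ (gardingEnd_single_mem_of_ne hτ hτu hτi h _)
    (Subalgebra.smul_mem _ (gardingEnd_single_mem_of_ne hτ hτu hτi h _) _)

/-! ### 4. `ad`-eigen property of the letters -/

/-- **The letters are `ad(𝔥 ⊗ K_∞)`-eigenvectors**: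
`D(E_{ij} ⊗ v₁ y) + β D(E_{ij} ⊗ v₂ y) = letterEval a y · placeLetter i j a`. [folklore] -/
theorem gardingEnd_single_letterVec_mul (hτ : τ.IsStronglyContinuous) (i j : Fin 2) (a : GL2Letter K) (y : mixedSpace K) :
    gardingEnd (hcpt := hcpt) (τ := τ) hτ (Matrix.single i j (letterVec₁ K a * y)) +
        letterCoef K a • gardingEnd hτ (Matrix.single i j (letterVec₂ K a * y)) =
      letterEval a y • placeLetter hτ i j a := by
  rcases a with w | ⟨w, b⟩
  · simp only [letterVec₁, letterVec₂, letterCoef, letterEval, placeLetter, zero_mul, zero_smul, add_zero]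
    rw [realIdem_mul, ← Matrix.smul_single, gardingEnd_smul]
  · simp only [letterVec₁, letterVec₂, placeLetter]
    rw [complexIdem_mul, complexIdemI_mul, Matrix.single_add, Matrix.single_add, gardingEnd_add, gardingEnd_add,
      ← Matrix.smul_single, ← Matrix.smul_single, ← Matrix.smul_single, ← Matrix.smul_single,
      gardingEnd_smul, gardingEnd_smul, gardingEnd_smul, gardingEnd_smul]
    set Dc := gardingEnd (hcpt := hcpt) (τ := τ) hτ (Matrix.single i j ((0, Pi.single w 1) : mixedSpace K))
    set Dic := gardingEnd (hcpt := hcpt) (τ := τ) hτ (Matrix.single i j ((0, Pi.single w I) : mixedSpace K))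
    set z : ℂ := y.2 w with hz
    set β : ℂ := letterCoef K (Sum.inr (w, b)) with hβ
    have hL : ((z.re : ℂ) • Dc + (z.im : ℂ) • Dic) + β • (((-z.im : ℝ) : ℂ) • Dc + (z.re : ℂ) • Dic) =
        ((z.re : ℂ) + β * -(z.im : ℂ)) • Dc + ((z.im : ℂ) + β * (z.re : ℂ)) • Dic := by
      rw [Complex.ofReal_neg]; module
    have hR : letterEval (Sum.inr (w, b)) y • (Dc + β • Dic) =
        letterEval (Sum.inr (w, b)) y • Dc + (letterEval (Sum.inr (w, b)) y * β) • Dic := by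
      module
    have h1 : (z.re : ℂ) + β * -(z.im : ℂ) = letterEval (Sum.inr (w, b)) y := by
      cases b <;> (simp only [hβ, letterCoef, letterEval, ← hz]; apply Complex.ext <;> simp)
    have h2 : (z.im : ℂ) + β * (z.re : ℂ) = letterEval (Sum.inr (w, b)) y * β := by
      cases b <;> (simp only [hβ, letterCoef, letterEval, ← hz]; apply Complex.ext <;> simp)
    rw [hL, hR, h1, h2]

/-- `[e⁻_a, D(E₀₀ ⊗ y)] = letterEval a y · e⁻_a`. [folklore] -/
theorem placeLetter10_mul_gardingEnd_single00 (hτ : τ.IsStronglyContinuous) (a : GL2Letter K) (y : mixedSpace K) :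
    placeLetter (hcpt := hcpt) (τ := τ) hτ 1 0 a * gardingEnd hτ (Matrix.single 0 0 y) =
      gardingEnd hτ (Matrix.single 0 0 y) * placeLetter hτ 1 0 a + letterEval a y • placeLetter hτ 1 0 a := by
  rw [← gardingEnd_single_letterVec_mul hτ 1 0 a y]
  simp only [placeLetter, add_mul, mul_add, smul_mul_assoc, mul_smul_comm]
  rw [gardingEnd_mul_eq hτ (Matrix.single 1 0 (letterVec₁ K a)), gardingEnd_mul_eq hτ (Matrix.single 1 0 (letterVec₂ K a)),
    single10_comm_single00, single10_comm_single00, smul_add]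
  abel

/-- `[e⁻_a, D(E₀₁ ⊗ y)] ∈ B` (it is `D((E₁₁ - E₀₀) ⊗ v₁ y) + β D((E₁₁ - E₀₀) ⊗ v₂ y)`). [folklore] -/
theorem placeLetter10_mul_gardingEnd_single01 (hτ : τ.IsStronglyContinuous) (hτu : τ.IsUnitary) (hτi : τ.IsTopIrreducible)
    (a : GL2Letter K) (y : mixedSpace K) :
    ∃ b₂ ∈ borelAlg hcpt τ hτ, placeLetter (hcpt := hcpt) (τ := τ) hτ 1 0 a * gardingEnd hτ (Matrix.single 0 1 y) =
      gardingEnd hτ (Matrix.single 0 1 y) * placeLetter hτ 1 0 a + b₂ := by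
  refine ⟨gardingEnd hτ (Matrix.single 1 1 (letterVec₁ K a * y) - Matrix.single 0 0 (y * letterVec₁ K a)) +
      letterCoef K a • gardingEnd hτ (Matrix.single 1 1 (letterVec₂ K a * y) - Matrix.single 0 0 (y * letterVec₂ K a)), ?_, ?_⟩
  · refine Subalgebra.add_mem _ ?_ (Subalgebra.smul_mem _ ?_ _)
    · rw [gardingEnd_sub]
      exact Subalgebra.sub_mem _ (gardingEnd_single11_mem hτ hτu hτi _) (gardingEnd_single00_mem hτ _)
    · rw [gardingEnd_sub]
      exact Subalgebra.sub_mem _ (gardingEnd_single11_mem hτ hτu hτi _) (gardingEnd_single00_mem hτ _)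
  · simp only [placeLetter, add_mul, mul_add, smul_mul_assoc, mul_smul_comm]
    rw [gardingEnd_mul_eq hτ (Matrix.single 1 0 (letterVec₁ K a)), gardingEnd_mul_eq hτ (Matrix.single 1 0 (letterVec₂ K a)),
      single10_comm_single01, single10_comm_single01, smul_add]
    abel

/-- **(H1) for generators**: for each generator `t` of `B`, `e⁻_a t = b₁ e⁻_a + b₂` with `b₁, b₂ ∈ B`. [folklore] -/
theorem placeLetter10_mul_generator (hτ : τ.IsStronglyContinuous) (hτu : τ.IsUnitary) (hτi : τ.IsTopIrreducible)
    (a : GL2Letter K) {t : Module.End ℂ (archGardingSpace hcpt τ)}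
    (ht : t ∈ Set.range (fun x : mixedSpace K => gardingEnd (hcpt := hcpt) (τ := τ) hτ (Matrix.single 0 0 x)) ∪
      Set.range (fun x : mixedSpace K => gardingEnd (hcpt := hcpt) (τ := τ) hτ (Matrix.single 0 1 x))) :
    ∃ b₁ ∈ borelAlg hcpt τ hτ, ∃ b₂ ∈ borelAlg hcpt τ hτ, placeLetter hτ 1 0 a * t = b₁ * placeLetter hτ 1 0 a + b₂ := by
  rcases ht with ⟨y, rfl⟩ | ⟨y, rfl⟩
  · refine ⟨gardingEnd hτ (Matrix.single 0 0 y) + letterEval a y • 1,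
      Subalgebra.add_mem _ (gardingEnd_single00_mem hτ y) (Subalgebra.smul_mem _ (Subalgebra.one_mem _) _), 0,
      Subalgebra.zero_mem _, ?_⟩
    rw [placeLetter10_mul_gardingEnd_single00, add_mul, smul_mul_assoc, one_mul, add_zero]
  · obtain ⟨b₂, hb₂, h⟩ := placeLetter10_mul_gardingEnd_single01 hτ hτu hτi a y
    exact ⟨gardingEnd hτ (Matrix.single 0 1 y), gardingEnd_single01_mem hτ y, b₂, hb₂, h⟩

/-- **(H1)**: `e⁻_a b ∈ B e⁻_a + B` for every `b ∈ B` (from the generators by induction on `B = ℂ⟨…⟩`).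
[cite: JacquetShalikaAJM1981, §3, Lemma (3.4)] -/
theorem placeLetter10_mul_mem (hτ : τ.IsStronglyContinuous) (hτu : τ.IsUnitary) (hτi : τ.IsTopIrreducible)
    (a : GL2Letter K) {b : Module.End ℂ (archGardingSpace hcpt τ)} (hb : b ∈ borelAlg hcpt τ hτ) :
    ∃ b₁ ∈ borelAlg hcpt τ hτ, ∃ b₂ ∈ borelAlg hcpt τ hτ, placeLetter hτ 1 0 a * b = b₁ * placeLetter hτ 1 0 a + b₂ := by
  induction hb using Algebra.adjoin_induction with
  | mem t ht => exact placeLetter10_mul_generator hτ hτu hτi a ht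
  | algebraMap c =>
    refine ⟨algebraMap ℂ _ c, Subalgebra.algebraMap_mem _ c, 0, Subalgebra.zero_mem _, ?_⟩
    rw [add_zero, Algebra.algebraMap_eq_smul_one, smul_mul_assoc, one_mul, mul_smul_comm, mul_one]
  | add x x' _ _ ihx ihx' =>
    obtain ⟨b₁, hb₁, b₂, hb₂, h⟩ := ihx
    obtain ⟨b₁', hb₁', b₂', hb₂', h'⟩ := ihx'
    refine ⟨b₁ + b₁', Subalgebra.add_mem _ hb₁ hb₁', b₂ + b₂', Subalgebra.add_mem _ hb₂ hb₂', ?_⟩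
    rw [mul_add, h, h', add_mul]; abel
  | mul x x' _ _ ihx ihx' =>
    obtain ⟨b₁, hb₁, b₂, hb₂, h⟩ := ihx
    obtain ⟨b₁', hb₁', b₂', hb₂', h'⟩ := ihx'
    refine ⟨b₁ * b₁', Subalgebra.mul_mem _ hb₁ hb₁', b₁ * b₂' + b₂ * x',
      Subalgebra.add_mem _ (Subalgebra.mul_mem _ hb₁ hb₂') (Subalgebra.mul_mem _ hb₂ ‹x' ∈ _›), ?_⟩
    rw [← mul_assoc, h, add_mul, mul_assoc, h', mul_add, ← mul_assoc]; abel

/-! ### 5. (H3): distinct letters commute across -/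

omit [CompleteSpace E] in
/-- Bilinear expansion of a commutator of two-term combinations in `End(𝒢)`. [folklore] -/
theorem add_smul_mul_comm_expand (A₁ A₂ B₁ B₂ : Module.End ℂ (archGardingSpace hcpt τ)) (α β : ℂ) :
    (A₁ + α • A₂) * (B₁ + β • B₂) - (B₁ + β • B₂) * (A₁ + α • A₂) =
      (A₁ * B₁ - B₁ * A₁) + β • (A₁ * B₂ - B₂ * A₁) + α • (A₂ * B₁ - B₁ * A₂) + (α * β) • (A₂ * B₂ - B₂ * A₂) := by
  simp only [mul_add, add_mul, smul_mul_assoc, mul_smul_comm]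
  module

/-- The commutator of a lowering and a raising letter: bilinear expansion into the four commutators
`[D(E₁₀ ⊗ v_s a), D(E₀₁ ⊗ v_t a')] = D(E₁₁ ⊗ v_s v_t) - D(E₀₀ ⊗ v_t v_s)`. [folklore] -/
theorem placeLetter10_mul_placeLetter01_sub (hτ : τ.IsStronglyContinuous) (a a' : GL2Letter K) :
    placeLetter (hcpt := hcpt) (τ := τ) hτ 1 0 a * placeLetter hτ 0 1 a' - placeLetter hτ 0 1 a' * placeLetter hτ 1 0 a =
      gardingEnd hτ (Matrix.single 1 1 (letterVec₁ K a * letterVec₁ K a') - Matrix.single 0 0 (letterVec₁ K a' * letterVec₁ K a)) +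
      letterCoef K a' • gardingEnd hτ (Matrix.single 1 1 (letterVec₁ K a * letterVec₂ K a') - Matrix.single 0 0 (letterVec₂ K a' * letterVec₁ K a)) +
      letterCoef K a • gardingEnd hτ (Matrix.single 1 1 (letterVec₂ K a * letterVec₁ K a') - Matrix.single 0 0 (letterVec₁ K a' * letterVec₂ K a)) +
      (letterCoef K a * letterCoef K a') •
        gardingEnd hτ (Matrix.single 1 1 (letterVec₂ K a * letterVec₂ K a') - Matrix.single 0 0 (letterVec₂ K a' * letterVec₂ K a)) := by
  simp only [placeLetter]
  rw [add_smul_mul_comm_expand, gardingEnd_commutator, gardingEnd_commutator, gardingEnd_commutator, gardingEnd_commutator,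
    single10_comm_single01, single10_comm_single01, single10_comm_single01, single10_comm_single01]

/-- **(H3)**: `e⁻_a e⁺_{a'} = e⁺_{a'} e⁻_a` for `a ≠ a'` (different places are orthogonal in `K_∞`; at one
complex place `[hol⁻, anti⁺] = 0`). [cite: JacquetShalikaAJM1981, §3, proof of Prop. (3.8)] -/
theorem placeLetter10_mul_placeLetter01_of_ne (hτ : τ.IsStronglyContinuous) {a a' : GL2Letter K} (h : a ≠ a') :
    placeLetter (hcpt := hcpt) (τ := τ) hτ 1 0 a * placeLetter hτ 0 1 a' = placeLetter hτ 0 1 a' * placeLetter hτ 1 0 a := by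
  rw [← sub_eq_zero, placeLetter10_mul_placeLetter01_sub]
  rcases a with w | ⟨w, b⟩ <;> rcases a' with w' | ⟨w', b'⟩
  · have hww : w ≠ w' := fun e => h (by rw [e])
    simp only [letterVec₁, letterVec₂, letterCoef, realIdem_mul_realIdem_of_ne hww, realIdem_mul_realIdem_of_ne (Ne.symm hww),
      zero_mul, mul_zero, Matrix.single_zero, sub_zero, gardingEnd_zero, smul_zero, add_zero]
  · simp only [letterVec₁, letterVec₂, letterCoef, realIdem_mul_inr, inr_mul_realIdem, zero_mul, mul_zero, Matrix.single_zero,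
      sub_zero, gardingEnd_zero, smul_zero, add_zero]
  · simp only [letterVec₁, letterVec₂, letterCoef, realIdem_mul_inr, inr_mul_realIdem, zero_mul, mul_zero, Matrix.single_zero,
      sub_zero, gardingEnd_zero, smul_zero, add_zero]
  · by_cases hww : w = w'
    · subst hww
      have hbb : b ≠ b' := fun e => h (by rw [e])
      simp only [letterVec₁, letterVec₂, inrSingle_mul_inrSingle_same, one_mul, mul_one, Complex.I_mul_I, inrSingle_neg_one,
        single_neg', sub_neg_eq_add, gardingEnd_sub, gardingEnd_add, gardingEnd_neg]
      set A := gardingEnd (hcpt := hcpt) (τ := τ) hτ (Matrix.single 1 1 ((0, Pi.single w 1) : mixedSpace K))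
      set B' := gardingEnd (hcpt := hcpt) (τ := τ) hτ (Matrix.single 0 0 ((0, Pi.single w 1) : mixedSpace K))
      set C := gardingEnd (hcpt := hcpt) (τ := τ) hτ (Matrix.single 1 1 ((0, Pi.single w I) : mixedSpace K))
      set D := gardingEnd (hcpt := hcpt) (τ := τ) hτ (Matrix.single 0 0 ((0, Pi.single w I) : mixedSpace K))
      have hprod : letterCoef K (Sum.inr (w, b)) * letterCoef K (Sum.inr (w, b')) = 1 := by
        cases b <;> cases b' <;> simp_all [letterCoef]
      have hb' : letterCoef K (Sum.inr (w, b')) = -letterCoef K (Sum.inr (w, b)) := by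
        cases b <;> cases b' <;> simp_all [letterCoef]
      rw [hprod, hb']
      module
    · simp only [letterVec₁, letterVec₂, letterCoef, inrSingle_mul_inrSingle_of_ne hww, inrSingle_mul_inrSingle_of_ne (Ne.symm hww),
        Matrix.single_zero, sub_zero, gardingEnd_zero, smul_zero, add_zero]

/-! ### 6. Infinitesimal Whittaker covariance of the raising letters -/

omit [NumberField K] in
/-- `Tr(r_w) = 1`. [folklore] -/
theorem mixedTrace_realIdem [NumberField K] (w : {w : InfinitePlace K // IsReal w}) :
    mixedTrace K ((Pi.single w 1, 0) : mixedSpace K) = 1 := by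
  simp [mixedTrace_apply, Pi.single_apply]

omit [NumberField K] in
/-- `Tr(c_w) = 2`. [folklore] -/
theorem mixedTrace_complexIdem [NumberField K] (w : {w : InfinitePlace K // IsComplex w}) :
    mixedTrace K ((0, Pi.single w 1) : mixedSpace K) = 2 := by
  simp [mixedTrace_apply, Pi.single_apply, apply_ite Complex.re]

omit [NumberField K] in
/-- `Tr(i c_w) = 0`. [folklore] -/
theorem mixedTrace_complexIdemI [NumberField K] (w : {w : InfinitePlace K // IsComplex w}) :
    mixedTrace K ((0, Pi.single w I) : mixedSpace K) = 0 := by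
  simp [mixedTrace_apply, Pi.single_apply, apply_ite Complex.re]

/-- `ℓ ∘ D(E₀₁ ⊗ x) = -2πi Tr(x) · ℓ` for a continuous Whittaker functional `ℓ`. [folklore] -/
theorem comp_gardingEnd_single01 {hτ : τ.IsStronglyContinuous} {ℓ : archGardingSpace hcpt τ →ₗ[ℂ] ℂ}
    (hℓ : IsArchContWhittakerFunctional hcpt τ hτ ℓ) (x : mixedSpace K) :
    ℓ.comp (gardingEnd hτ (Matrix.single 0 1 x)) = ((((-(2 * π) * mixedTrace K x : ℝ)) : ℂ) * I) • ℓ := by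
  refine LinearMap.ext fun v => ?_
  rw [LinearMap.comp_apply, LinearMap.smul_apply, smul_eq_mul]
  have h := hℓ.apply_archDerivE_single_simple (i := (0 : Fin 2)) (j := (1 : Fin 2)) rfl x v.2
  exact h

/-- **Whittaker covariance of the raising letters**: `ℓ ∘ e⁺_a = letterChar a · ℓ`
(`Tr r_w = 1`, `Tr c_w = 2`, `Tr (i c_w) = 0`). [cite: JacquetShalikaAJM1981, §3, proof of Prop. (3.8), (2)] -/
theorem comp_placeLetter01 {hτ : τ.IsStronglyContinuous} {ℓ : archGardingSpace hcpt τ →ₗ[ℂ] ℂ}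
    (hℓ : IsArchContWhittakerFunctional hcpt τ hτ ℓ) (a : GL2Letter K) :
    ℓ.comp (placeLetter hτ 0 1 a) = letterChar a • ℓ := by
  rcases a with w | ⟨w, b⟩
  · rw [placeLetter_inl, comp_gardingEnd_single01 hℓ, mixedTrace_realIdem]
    simp [letterChar]
  · rw [placeLetter_inr, LinearMap.comp_add, LinearMap.comp_smul, comp_gardingEnd_single01 hℓ, comp_gardingEnd_single01 hℓ,
      mixedTrace_complexIdem, mixedTrace_complexIdemI]
    simp only [letterChar, mul_zero, Complex.ofReal_zero, zero_mul, zero_smul, smul_zero, add_zero]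
    congr 1
    push_cast
    ring

/-! ### 7. (H2): `e⁻_a e⁺_a ∈ B` from the place Casimir scalars -/

/-- The real-place letter applied: `D(E_{ij} ⊗ r_w) u`. [folklore] -/
theorem coe_placeLetter_inl_apply (hτ : τ.IsStronglyContinuous) (i j : Fin 2) (w : {w : InfinitePlace K // IsReal w})
    (u : archGardingSpace hcpt τ) :
    ((placeLetter hτ i j (Sum.inl w) u : archGardingSpace hcpt τ) : E) =
      archDerivE hcpt τ (Matrix.single i j ((Pi.single w 1, 0) : mixedSpace K)) u := by
  rw [placeLetter_inl, coe_gardingEnd_apply]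

/-- The holomorphic letter applied is `τ^{hol}(E_{ij}) u`. [folklore] -/
theorem coe_placeLetter_hol_apply (hτ : τ.IsStronglyContinuous) (i j : Fin 2) (w : {w : InfinitePlace K // IsComplex w})
    (u : archGardingSpace hcpt τ) :
    ((placeLetter hτ i j (Sum.inr (w, false)) u : archGardingSpace hcpt τ) : E) = archDerivHol hcpt τ w i j u := by
  rw [placeLetter_inr, LinearMap.add_apply, LinearMap.smul_apply, Submodule.coe_add, Submodule.coe_smul, coe_gardingEnd_apply,
    coe_gardingEnd_apply, archDerivHol]
  simp only [letterCoef, neg_smul, sub_eq_add_neg]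

/-- The antiholomorphic letter applied is `τ^{anti}(E_{ij}) u`. [folklore] -/
theorem coe_placeLetter_anti_apply (hτ : τ.IsStronglyContinuous) (i j : Fin 2) (w : {w : InfinitePlace K // IsComplex w})
    (u : archGardingSpace hcpt τ) :
    ((placeLetter hτ i j (Sum.inr (w, true)) u : archGardingSpace hcpt τ) : E) = archDerivAnti hcpt τ w i j u := by
  rw [placeLetter_inr, LinearMap.add_apply, LinearMap.smul_apply, Submodule.coe_add, Submodule.coe_smul, coe_gardingEnd_apply,
    coe_gardingEnd_apply, archDerivAnti]
  simp only [letterCoef]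

/-- Transport of a Casimir identity on `𝒢` to `End(𝒢)`. [folklore] -/
theorem sum_placeLetter_mul_eq_of_forall (hτ : τ.IsStronglyContinuous) (a : GL2Letter K) (F : Fin 2 → Fin 2 → E → E) (c : ℂ)
    (hF : ∀ (i j : Fin 2) (u : archGardingSpace hcpt τ), ((placeLetter hτ i j a u : archGardingSpace hcpt τ) : E) = F i j u)
    (hc : ∀ v ∈ archGardingSpace hcpt τ, ∑ i, ∑ j, F i j (F j i v) = c • v) :
    ∑ i : Fin 2, ∑ j : Fin 2, placeLetter (hcpt := hcpt) (τ := τ) hτ i j a * placeLetter hτ j i a = c • 1 := by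
  refine LinearMap.ext fun v => Subtype.ext ?_
  rw [LinearMap.smul_apply, Module.End.one_apply, Submodule.coe_smul, ← hc _ v.2, LinearMap.sum_apply,
    AddSubmonoidClass.coe_finsetSum]
  refine Finset.sum_congr rfl fun i _ => ?_
  rw [LinearMap.sum_apply, AddSubmonoidClass.coe_finsetSum]
  refine Finset.sum_congr rfl fun j _ => ?_
  rw [Module.End.mul_apply, hF, hF]

/-- **The place Casimir at position letters** is a scalar: `Σ_{ij} (letter_{ij} a)(letter_{ji} a) = c · 1`
(real place: `ArchPlaceCasimirScalar.exists_placeCasimirReal_eq_smul`; complex place: the holomorphic /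
antiholomorphic Casimir). [cite: Knapp1986, Ch. VIII §3] -/
theorem exists_sum_placeLetter_mul_eq (hτ : τ.IsStronglyContinuous) (hτu : τ.IsUnitary) (hτi : τ.IsTopIrreducible)
    (a : GL2Letter K) :
    ∃ c : ℂ, ∑ i : Fin 2, ∑ j : Fin 2, placeLetter (hcpt := hcpt) (τ := τ) hτ i j a * placeLetter hτ j i a = c • 1 := by
  rcases a with w | ⟨w, b⟩
  · obtain ⟨c, hc⟩ := exists_placeCasimirReal_eq_smul (hcpt := hcpt) (τ := τ) hτ hτu hτi w
    exact ⟨c, sum_placeLetter_mul_eq_of_forall hτ _ _ c (fun i j u => coe_placeLetter_inl_apply hτ i j w u) hc⟩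
  · cases b
    · obtain ⟨c, hc⟩ := exists_placeCasimirHol_eq_smul (hcpt := hcpt) (τ := τ) hτ hτu hτi w
      exact ⟨c, sum_placeLetter_mul_eq_of_forall hτ _ _ c (fun i j u => coe_placeLetter_hol_apply hτ i j w u) hc⟩
    · obtain ⟨c, hc⟩ := exists_placeCasimirAnti_eq_smul (hcpt := hcpt) (τ := τ) hτ hτu hτi w
      exact ⟨c, sum_placeLetter_mul_eq_of_forall hτ _ _ c (fun i j u => coe_placeLetter_anti_apply hτ i j w u) hc⟩

/-- `[e⁺_a, e⁻_a] = m_a (letter₀₀ a - letter₁₁ a)` with `m_a = 1` (real) or `2` (complex). [folklore] -/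
theorem placeLetter01_mul_placeLetter10_sub (hτ : τ.IsStronglyContinuous) (a : GL2Letter K) :
    ∃ m : ℂ, placeLetter (hcpt := hcpt) (τ := τ) hτ 0 1 a * placeLetter hτ 1 0 a - placeLetter hτ 1 0 a * placeLetter hτ 0 1 a =
      m • (placeLetter hτ 0 0 a - placeLetter hτ 1 1 a) := by
  have key : placeLetter (hcpt := hcpt) (τ := τ) hτ 0 1 a * placeLetter hτ 1 0 a - placeLetter hτ 1 0 a * placeLetter hτ 0 1 a =
      gardingEnd hτ (Matrix.single 0 0 (letterVec₁ K a * letterVec₁ K a) - Matrix.single 1 1 (letterVec₁ K a * letterVec₁ K a)) +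
      letterCoef K a • gardingEnd hτ (Matrix.single 0 0 (letterVec₁ K a * letterVec₂ K a) - Matrix.single 1 1 (letterVec₂ K a * letterVec₁ K a)) +
      letterCoef K a • gardingEnd hτ (Matrix.single 0 0 (letterVec₂ K a * letterVec₁ K a) - Matrix.single 1 1 (letterVec₁ K a * letterVec₂ K a)) +
      (letterCoef K a * letterCoef K a) •
        gardingEnd hτ (Matrix.single 0 0 (letterVec₂ K a * letterVec₂ K a) - Matrix.single 1 1 (letterVec₂ K a * letterVec₂ K a)) := by
    simp only [placeLetter]
    rw [add_smul_mul_comm_expand, gardingEnd_commutator, gardingEnd_commutator, gardingEnd_commutator, gardingEnd_commutator,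
      single01_comm_single10, single01_comm_single10, single01_comm_single10, single01_comm_single10]
  rw [key]
  rcases a with w | ⟨w, b⟩
  · refine ⟨1, ?_⟩
    simp only [letterVec₁, letterVec₂, letterCoef, placeLetter, realIdem_mul_self, zero_mul, mul_zero,
      Matrix.single_zero, sub_zero, gardingEnd_zero, smul_zero, add_zero, one_smul, gardingEnd_sub]
  · refine ⟨2, ?_⟩
    simp only [letterVec₁, letterVec₂, placeLetter, inrSingle_mul_inrSingle_same, one_mul, mul_one, Complex.I_mul_I,
      inrSingle_neg_one, single_neg', sub_neg_eq_add, gardingEnd_sub, gardingEnd_add, gardingEnd_neg]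
    have hprod : letterCoef K (Sum.inr (w, b)) * letterCoef K (Sum.inr (w, b)) = -1 := by
      cases b <;> simp [letterCoef]
    rw [hprod]
    module

/-- **(H2)**: `e⁻_a e⁺_a ∈ B` — from `Σ_{ij} letter_{ij} letter_{ji} = c` and `[e⁺_a, e⁻_a] ∈ B`:
`2 e⁻ e⁺ = c - letter₀₀² - letter₁₁² - [e⁺, e⁻]`. [cite: JacquetShalikaAJM1981, §3, proof of Prop. (3.8), p. 523] -/
theorem placeLetter10_mul_placeLetter01_mem (hτ : τ.IsStronglyContinuous) (hτu : τ.IsUnitary) (hτi : τ.IsTopIrreducible)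
    (a : GL2Letter K) : placeLetter hτ 1 0 a * placeLetter hτ 0 1 a ∈ borelAlg hcpt τ hτ := by
  obtain ⟨c, hc⟩ := exists_sum_placeLetter_mul_eq (hcpt := hcpt) (τ := τ) hτ hτu hτi a
  obtain ⟨m, hm⟩ := placeLetter01_mul_placeLetter10_sub (hcpt := hcpt) (τ := τ) hτ a
  simp only [Fin.sum_univ_two] at hc
  set L := placeLetter (hcpt := hcpt) (τ := τ) hτ 1 0 a
  set R := placeLetter (hcpt := hcpt) (τ := τ) hτ 0 1 a
  set H₀ := placeLetter (hcpt := hcpt) (τ := τ) hτ 0 0 a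
  set H₁ := placeLetter (hcpt := hcpt) (τ := τ) hτ 1 1 a
  -- `hc : H₀ H₀ + R L + (L R + H₁ H₁) = c • 1`, `hm : R L - L R = m • (H₀ - H₁)`
  have h2 : L * R = (2 : ℂ)⁻¹ • (c • 1 - H₀ * H₀ - H₁ * H₁ - m • (H₀ - H₁)) := by
    have e1 : R * L = L * R + m • (H₀ - H₁) := by rw [← hm]; abel
    rw [e1] at hc
    have e2 : (2 : ℂ) • (L * R) = c • 1 - H₀ * H₀ - H₁ * H₁ - m • (H₀ - H₁) := by
      rw [← hc, two_smul]; abel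
    rw [← e2, smul_smul, inv_mul_cancel₀ (two_ne_zero), one_smul]
  rw [h2]
  have hH₀ : H₀ ∈ borelAlg hcpt τ hτ := placeLetter_mem_of_ne hτ hτu hτi (by simp) a
  have hH₁ : H₁ ∈ borelAlg hcpt τ hτ := placeLetter_mem_of_ne hτ hτu hτi (by simp) a
  refine Subalgebra.smul_mem _ (Subalgebra.sub_mem _ (Subalgebra.sub_mem _ (Subalgebra.sub_mem _
    (Subalgebra.smul_mem _ (Subalgebra.one_mem _) _) (Subalgebra.mul_mem _ hH₀ hH₀)) (Subalgebra.mul_mem _ hH₁ hH₁))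
    (Subalgebra.smul_mem _ (Subalgebra.sub_mem _ hH₀ hH₁) _)) _

/-! ### 8. Degrees: every letter has finite `e⁻`-degree over `B` -/

open Literature.Algebra.Lie.WhittakerDescent in
/-- `D(E₁₀ ⊗ x) = Σ_a letterCoord a x · e⁻_a` has degree `≤ 1`. [folklore] -/
theorem gardingEnd_single10_mem_degFilt_one (hτ : τ.IsStronglyContinuous) (x : mixedSpace K) :
    gardingEnd hτ (Matrix.single 1 0 x) ∈ degFilt (borelAlg hcpt τ hτ) (placeLetter hτ 1 0) 1 := by
  rw [degFilt_succ, mem_mulRepSubmodule_iff, gardingEnd_single_eq_sum_placeLetter]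
  refine ⟨0, (degFilt (borelAlg hcpt τ hτ) (placeLetter hτ 1 0) 0).zero_mem, fun a => letterCoord a x • 1,
    fun a => (mem_degFilt_zero_iff _ _ _).2 (Subalgebra.smul_mem _ (Subalgebra.one_mem _) _), ?_⟩
  rw [zero_add]
  exact Finset.sum_congr rfl fun a _ => by rw [smul_mul_assoc, one_mul]

open Literature.Algebra.Lie.WhittakerDescent in
/-- **Every elementary letter `D(E_{ij} ⊗ x)` has finite `e⁻`-degree over `B`.** [folklore] -/
theorem exists_mem_degFilt_gardingEnd_single (hτ : τ.IsStronglyContinuous) (hτu : τ.IsUnitary) (hτi : τ.IsTopIrreducible)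
    (i j : Fin 2) (x : mixedSpace K) :
    ∃ J, gardingEnd hτ (Matrix.single i j x) ∈ degFilt (borelAlg hcpt τ hτ) (placeLetter hτ 1 0) J := by
  by_cases h : i = 1 ∧ j = 0
  · obtain ⟨rfl, rfl⟩ := h
    exact ⟨1, gardingEnd_single10_mem_degFilt_one hτ x⟩
  · exact ⟨0, (mem_degFilt_zero_iff _ _ _).2 (gardingEnd_single_mem_of_ne hτ hτu hτi h x)⟩

open Literature.Algebra.Lie.WhittakerDescent in
/-- **Every letter `D(X)`, `X ∈ M₂(K_∞)`, lies in the subalgebra generated by the elementary letters**, hence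
every word operator has finite `e⁻`-degree over `B`. [cite: JacquetShalikaAJM1981, §3, Lemma (3.4)] -/
theorem exists_mem_degFilt_prod_map_gardingEnd (hτ : τ.IsStronglyContinuous) (hτu : τ.IsUnitary) (hτi : τ.IsTopIrreducible)
    (w : List (Matrix (Fin 2) (Fin 2) (mixedSpace K))) :
    ∃ J, (w.map (gardingEnd (hcpt := hcpt) (τ := τ) hτ)).prod ∈ degFilt (borelAlg hcpt τ hτ) (placeLetter hτ 1 0) J := by
  set T : Set (Module.End ℂ (archGardingSpace hcpt τ)) :=
    {t | ∃ (i j : Fin 2) (x : mixedSpace K), t = gardingEnd (hcpt := hcpt) (τ := τ) hτ (Matrix.single i j x)} with hT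
  have hT' : ∀ t ∈ T, ∃ J, t ∈ degFilt (borelAlg hcpt τ hτ) (placeLetter hτ 1 0) J := by
    rintro t ⟨i, j, x, rfl⟩
    exact exists_mem_degFilt_gardingEnd_single hτ hτu hτi i j x
  refine exists_mem_degFilt_of_mem_adjoin (borelAlg hcpt τ hτ) (placeLetter hτ 1 0)
    (fun a b hb => placeLetter10_mul_mem hτ hτu hτi a hb) hT' ?_
  -- every letter is a sum of elementary letters
  have hletter : ∀ X : Matrix (Fin 2) (Fin 2) (mixedSpace K), gardingEnd (hcpt := hcpt) (τ := τ) hτ X ∈ Algebra.adjoin ℂ T := by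
    intro X
    rw [Matrix.matrix_eq_sum_single X, gardingEnd_sum]
    refine Subalgebra.sum_mem _ fun i _ => ?_
    rw [gardingEnd_sum]
    refine Subalgebra.sum_mem _ fun j _ => ?_
    exact Algebra.subset_adjoin ⟨i, j, X i j, rfl⟩
  induction w with
  | nil => rw [List.map_nil, List.prod_nil]; exact Subalgebra.one_mem _
  | cons X w ih => rw [List.map_cons, List.prod_cons]; exact Subalgebra.mul_mem _ (hletter X) ih

end Letters

end Literature.NumberTheory.Automorphic
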